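import Summits.ValiantsHypothesis.ValiantsHypothesis.Theorems.SymPencilPerFourCrossPairNoJoint

/-!
# Route `SymPencil` — the cross elements `E₀₁ + p₁E₁₀ + p₂E₂₀ + p₃E₃₀` (`p₁p₂p₃ ≠ 0`) have Hessian
# rank `6`: no per-direction family of `< 6` squares on a subspace containing one of them
# (`--supports` stmt-ValiantsHypothesis-5674 `SdcSuperquadratic`; the "column plane" branch of
# Case B3 at dimension `5`, size-`27` cell `(11, 5, 4)`)

In Case B3 at dimension `5` (`SymPencilPerFourZeroCellStructure`, `SymPencilPerFourPermIsotropicPlanes`)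
the row-kernel `W₀` may be a `2`-plane `N` inside a column `c₀` (rows `≠ a`).  If `N` lies in a
coordinate hyperplane it IS that hyperplane and the product space is the cross space `V₅×`
(`SymPencilPerFourCrossPairNoJoint`); otherwise `N` contains a vector `p` with `p₁ p₂ p₃ ≠ 0`
(`SymPencilPerFourPermIsotropicPlanes.exists_forall_ne_zero`) and the product space contains,
after a column permutation, the matrix

  `y_p = E₀₁ + p₁ E₁₀ + p₂ E₂₀ + p₃ E₃₀`.

**Theorem** (`not_sqFamilySwap_crossElem`).  For `p₁ p₂ p₃ ≠ 0` (characteristic `0`) there is no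
per-direction family of `|ι| < 6` squares at `y_p`: the `s²`-coefficient
`Q(u) = p₁ (u₂₂u₃₃ + u₂₃u₃₂) + p₂ (u₁₂u₃₃ + u₁₃u₃₂) + p₃ (u₁₂u₂₃ + u₁₃u₂₂)` is
`M_p ⊗ (hyperbolic plane)` with `det M_p = 2 p₁p₂p₃`, rank `6` (common-kernel vector on the six
cells `{1,2,3} × {2,3}`, two `3 × 3` eliminations).  **Corollary**
(`not_sqFamilySwap_of_mem_crossElem`): no subspace containing `y_p` carries such a family.

Honest framing: a brick; `27 ≤ sdc(per₄) ≤ 29` unchanged, the crux `SdcSuperquadratic` and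
`VP ≠ VNP` untouched.  No definitions, no named facts. [folklore]
-/

noncomputable section

-- single-conjunct layout: Sub = Summit, duplicated namespace component intended
set_option linter.dupNamespace false

namespace Summit.ValiantsHypothesis.ValiantsHypothesis.Theorems.SymPencilPerFourCrossElemRankSix

open MvPolynomial Module Matrix
open Literature.Computability.AlgebraicComplexity
open Summit.ValiantsHypothesis.ValiantsHypothesis.Theorems.SymPencilBoxFourEquality
open Summit.ValiantsHypothesis.ValiantsHypothesis.Theorems.SymPencilPerFourCrossPairNoJoint

variable {K : Type*} [Field K]

/-- **The cross elements have Hessian rank `6`.**  See the module docstring. [folklore] -/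
theorem not_sqFamilySwap_crossElem [CharZero K] {ι : Type*} [Fintype ι]
    (hι : Fintype.card ι < 6) (p₁ p₂ p₃ : K) (hp₁ : p₁ ≠ 0) (hp₂ : p₂ ≠ 0) (hp₃ : p₃ ≠ 0)
    (c : ι → K) (Λ : ι → ((Fin 4 × Fin 4 → K) →ₗ[K] K)) :
    ¬ (∀ u : Fin 4 × Fin 4 → K, ∃ e₀ e₁ : K, ∀ s : K,
        eval (u + s • (fun q : Fin 4 × Fin 4 =>
          if q = (0, 1) then (1 : K) else if q = (1, 0) then p₁ else if q = (2, 0) then p₂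
          else if q = (3, 0) then p₃ else 0)) (perPoly (Fin 4) K) =
          e₀ + s * e₁ + s ^ 2 * ∑ k, c k * (Λ k u) ^ 2) := by
  classical
  intro hfam
  set y₀ : Fin 4 × Fin 4 → K := fun q =>
    if q = (0, 1) then (1 : K) else if q = (1, 0) then p₁ else if q = (2, 0) then p₂
    else if q = (3, 0) then p₃ else 0 with hy₀
  obtain ⟨f01, f02, f03, f10, f12, f13, f20, f21, f23, f30, f31, f32⟩ :
      (((0 : Fin 4) = 1) = False) ∧ (((0 : Fin 4) = 2) = False) ∧ (((0 : Fin 4) = 3) = False) ∧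
      (((1 : Fin 4) = 0) = False) ∧ (((1 : Fin 4) = 2) = False) ∧ (((1 : Fin 4) = 3) = False) ∧
      (((2 : Fin 4) = 0) = False) ∧ (((2 : Fin 4) = 1) = False) ∧ (((2 : Fin 4) = 3) = False) ∧
      (((3 : Fin 4) = 0) = False) ∧ (((3 : Fin 4) = 1) = False) ∧ (((3 : Fin 4) = 2) = False) := by
    refine ⟨?_, ?_, ?_, ?_, ?_, ?_, ?_, ?_, ?_, ?_, ?_, ?_⟩ <;> decide
  obtain ⟨e00, e01, e02, e10, e11, e12, e20, e21, e22, e30, e31, e32⟩ :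
      (0 : Fin 4).succAbove 0 = 1 ∧ (0 : Fin 4).succAbove 1 = 2 ∧ (0 : Fin 4).succAbove 2 = 3 ∧
      (1 : Fin 4).succAbove 0 = 0 ∧ (1 : Fin 4).succAbove 1 = 2 ∧ (1 : Fin 4).succAbove 2 = 3 ∧
      (2 : Fin 4).succAbove 0 = 0 ∧ (2 : Fin 4).succAbove 1 = 1 ∧ (2 : Fin 4).succAbove 2 = 3 ∧
      (3 : Fin 4).succAbove 0 = 0 ∧ (3 : Fin 4).succAbove 1 = 1 ∧ (3 : Fin 4).succAbove 2 = 2 := by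
    decide
  -- (A) the `s²`-coefficient
  obtain ⟨Q, hQ⟩ : ∃ Q : (Fin 4 × Fin 4 → K) → K, ∀ u, Q u =
      p₁ * (u (2, 2) * u (3, 3) + u (2, 3) * u (3, 2)) + p₂ * (u (1, 2) * u (3, 3) + u (1, 3) * u (3, 2)) +
        p₃ * (u (1, 2) * u (2, 3) + u (1, 3) * u (2, 2)) := ⟨_, fun _ => rfl⟩
  have hA : ∀ (u : Fin 4 × Fin 4 → K) (s : K), eval (u + s • y₀) (perPoly (Fin 4) K) =
      (Matrix.of fun i j => u (i, j)).permanent +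
      s * (((Matrix.of fun i j => u (i, j)).submatrix (0 : Fin 4).succAbove
            (1 : Fin 4).succAbove).permanent +
          p₁ * ((Matrix.of fun i j => u (i, j)).submatrix (1 : Fin 4).succAbove
            (0 : Fin 4).succAbove).permanent +
          p₂ * ((Matrix.of fun i j => u (i, j)).submatrix (2 : Fin 4).succAbove
            (0 : Fin 4).succAbove).permanent +
          p₃ * ((Matrix.of fun i j => u (i, j)).submatrix (3 : Fin 4).succAbove
            (0 : Fin 4).succAbove).permanent) +
      s ^ 2 * Q u := by
    intro u s
    rw [eval_perPoly, Matrix.permanent_fin_four_row, Matrix.permanent_fin_four_row, hQ]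
    simp only [Matrix.permanent_fin_three_row, Matrix.of_apply, Matrix.submatrix_apply, Pi.add_apply,
      Pi.smul_apply, smul_eq_mul, hy₀, Prod.mk.injEq, e00, e01, e02, e10, e11, e12, e20, e21,
      e22, e30, e31, e32, f01, f02, f03, f10, f12, f13, f20, f21, f23, f30, f31, f32, and_true,
      and_false, if_true, if_false]
    ring
  -- (B) coefficient extraction
  have hB : ∀ u : Fin 4 × Fin 4 → K, ∑ k, c k * (Λ k u) ^ 2 = Q u := by
    intro u
    obtain ⟨e₀, e₁, he⟩ := hfam u
    exact coeff_two_eq_of_forall₂ (fun s => (he s).symm.trans (hA u s))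
  -- (C) six test cells `{1,2,3} × {2,3}` and a common-kernel vector
  let U : (Fin 6 → K) →ₗ[K] (Fin 4 × Fin 4 → K) :=
    { toFun := fun n q => if q = (1, 2) then n 0 else if q = (1, 3) then n 1
        else if q = (2, 2) then n 2 else if q = (2, 3) then n 3
        else if q = (3, 2) then n 4 else if q = (3, 3) then n 5 else 0
      map_add' := fun a b => by
        ext q
        simp only [Pi.add_apply]
        split_ifs <;> simp
      map_smul' := fun a n => by
        ext q
        simp only [Pi.smul_apply, smul_eq_mul, RingHom.id_apply]
        split_ifs <;> simp }
  have hU : ∀ (n : Fin 6 → K) (q : Fin 4 × Fin 4), U n q = (if q = (1, 2) then n 0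
      else if q = (1, 3) then n 1 else if q = (2, 2) then n 2 else if q = (2, 3) then n 3
      else if q = (3, 2) then n 4 else if q = (3, 3) then n 5 else 0) := fun _ _ => rfl
  let M : (Fin 6 → K) →ₗ[K] (ι → K) := LinearMap.pi fun k => (Λ k).comp U
  have hM : ∀ n k, M n k = Λ k (U n) := fun n k => rfl
  have hker : LinearMap.ker M ≠ ⊥ := LinearMap.ker_ne_bot_of_finrank_lt (by
    rw [Module.finrank_fintype_fun_eq_card, Module.finrank_fintype_fun_eq_card, Fintype.card_fin]
    omega)
  obtain ⟨n, hn, hn0⟩ := Submodule.exists_mem_ne_zero_of_ne_bot hker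
  have hΛ0 : ∀ k, Λ k (U n) = 0 := fun k => by
    have := congr_fun (LinearMap.mem_ker.1 hn) k
    rwa [hM] at this
  -- (D) `Q (U n) = 0` and `Q (U n + e) = Q e`
  have hQn : Q (U n) = 0 := by
    rw [← hB (U n)]
    exact Finset.sum_eq_zero fun k _ => by rw [hΛ0 k]; ring
  have hQadd : ∀ e : Fin 4 × Fin 4 → K, Q (U n + e) = Q e := by
    intro e
    rw [← hB (U n + e), ← hB e]
    exact Finset.sum_congr rfl fun k _ => by rw [map_add, hΛ0 k, zero_add]
  obtain ⟨E, hE⟩ : ∃ E : Fin 4 × Fin 4 → (Fin 4 × Fin 4 → K), ∀ P q, E P q = if q = P then 1 else 0 :=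
    ⟨fun P q => if q = P then 1 else 0, fun _ _ => rfl⟩
  have r12 := hQadd (E (1, 2))
  have r13 := hQadd (E (1, 3))
  have r22 := hQadd (E (2, 2))
  have r23 := hQadd (E (2, 3))
  have r32 := hQadd (E (3, 2))
  have r33 := hQadd (E (3, 3))
  simp only [hQ, hU, hE, Pi.add_apply, Prod.mk.injEq, f12, f13, f21, f23, f31, f32, and_true,
    and_false, if_true, if_false] at r12 r13 r22 r23 r32 r33 hQn
  -- the six linear relations
  have Ea : p₃ * n 3 + p₂ * n 5 = 0 := by linear_combination r12 - hQn
  have Eb : p₃ * n 1 + p₁ * n 5 = 0 := by linear_combination r22 - hQn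
  have Ec : p₂ * n 1 + p₁ * n 3 = 0 := by linear_combination r32 - hQn
  have Ea' : p₃ * n 2 + p₂ * n 4 = 0 := by linear_combination r13 - hQn
  have Eb' : p₃ * n 0 + p₁ * n 4 = 0 := by linear_combination r23 - hQn
  have Ec' : p₂ * n 0 + p₁ * n 2 = 0 := by linear_combination r33 - hQn
  have h2 : (2 : K) ≠ 0 := two_ne_zero
  have k1 : (2 * p₂ * p₃) * n 1 = 0 := by linear_combination (p₂ * Eb - p₁ * Ea) + p₃ * Ec
  have k3 : (2 * p₁ * p₃) * n 3 = 0 := by linear_combination p₃ * Ec - (p₂ * Eb - p₁ * Ea)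
  have k5 : (2 * p₁ * p₂) * n 5 = 0 := by linear_combination p₁ * Ea + p₂ * Eb - p₃ * Ec
  have k0 : (2 * p₂ * p₃) * n 0 = 0 := by linear_combination (p₂ * Eb' - p₁ * Ea') + p₃ * Ec'
  have k2 : (2 * p₁ * p₃) * n 2 = 0 := by linear_combination p₃ * Ec' - (p₂ * Eb' - p₁ * Ea')
  have k4 : (2 * p₁ * p₂) * n 4 = 0 := by linear_combination p₁ * Ea' + p₂ * Eb' - p₃ * Ec'
  have c23 : (2 * p₂ * p₃ : K) ≠ 0 := mul_ne_zero (mul_ne_zero h2 hp₂) hp₃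
  have c13 : (2 * p₁ * p₃ : K) ≠ 0 := mul_ne_zero (mul_ne_zero h2 hp₁) hp₃
  have c12 : (2 * p₁ * p₂ : K) ≠ 0 := mul_ne_zero (mul_ne_zero h2 hp₁) hp₂
  apply hn0
  funext i
  fin_cases i
  · exact (mul_eq_zero.1 k0).resolve_left c23
  · exact (mul_eq_zero.1 k1).resolve_left c23
  · exact (mul_eq_zero.1 k2).resolve_left c13
  · exact (mul_eq_zero.1 k3).resolve_left c13
  · exact (mul_eq_zero.1 k4).resolve_left c12
  · exact (mul_eq_zero.1 k5).resolve_left c12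

/-- **No per-direction family of `< 6` squares on a subspace containing a cross element `y_p`
(`p₁p₂p₃ ≠ 0`).** [folklore] -/
theorem not_sqFamilySwap_of_mem_crossElem [CharZero K] {ι : Type*} [Fintype ι]
    (hι : Fintype.card ι < 6) (p₁ p₂ p₃ : K) (hp₁ : p₁ ≠ 0) (hp₂ : p₂ ≠ 0) (hp₃ : p₃ ≠ 0)
    (W : Submodule K (Fin 4 × Fin 4 → K))
    (hmem : (fun q : Fin 4 × Fin 4 =>
      if q = (0, 1) then (1 : K) else if q = (1, 0) then p₁ else if q = (2, 0) then p₂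
      else if q = (3, 0) then p₃ else 0) ∈ W) :
    ¬ (∀ y ∈ W, ∃ (c : ι → K) (Λ : ι → ((Fin 4 × Fin 4 → K) →ₗ[K] K)),
        ∀ u : Fin 4 × Fin 4 → K, ∃ e₀ e₁ : K, ∀ s : K,
          eval (u + s • y) (perPoly (Fin 4) K) = e₀ + s * e₁ + s ^ 2 * ∑ k, c k * (Λ k u) ^ 2) := by
  intro hW
  obtain ⟨c, Λ, h⟩ := hW _ hmem
  exact not_sqFamilySwap_crossElem hι p₁ p₂ p₃ hp₁ hp₂ hp₃ c Λ h

end Summit.ValiantsHypothesis.ValiantsHypothesis.Theorems.SymPencilPerFourCrossElemRankSix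

end
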